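import Mathlib.Analysis.SpecialFunctions.SmoothTransition
import Mathlib.Geometry.Manifold.PartitionOfUnity
import Mathlib.Analysis.Normed.Module.FiniteDimension
import Mathlib.MeasureTheory.Measure.Lebesgue.Basic
import HarnessLib

/-!
# Smooth lattice partitions of unity adapted to a cell

For a lattice `Λ = Ψ(ℤ^ι)` in a finite-dimensional real normed space `E` (`Ψ : ℝ^ι ≃ E` a basis
isomorphism) we construct compactly supported smooth functions `χ : E → [0, 1]` with
`Σ_{n ∈ ℤ^ι} χ (x - Ψ n) = 1` for all `x` — **smooth partitions of unity by lattice translates of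
one function** — which are moreover ADAPTED TO THE CELL `Ψ (c + [0,1]^ι)`: `χ ≡ 1` near every
point whose lattice coordinates minus `c` lie in `(2δ, 1 - 2δ)^ι` (the *core* of the cell) and
`χ ≡ 0` near the non-trivial lattice translates of core points (`LatticePU.cellPU`,
`cellPU_eq_one_of_mem_core`, `cellPU_eq_zero_of_mem_core_add`). Construction: a product
`b (x) = Π_i η (y_i (x) - c_i)` of one-variable plateau functions `η` (`= 1` on `[0, 1]`, supported in
`(-δ, 1 + δ)`, built from `Real.smoothTransition`) in the lattice coordinates `y = Ψ⁻¹`, divided by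
the locally finite, smooth, `Λ`-periodic sum `S = Σ_n b (· - Ψ n) ≥ 1`.

This is the standard device for descending compactly supported calculus to a torus `E/Λ`
("choose a smooth function with `Σ_λ χ(x - λ) = 1`"); it is used for the current of a periodic
analytic curve (`Literature/Analysis/Complex/PeriodicPlaneCurve.lean`). Everything is proved;
no citations beyond folklore.
-/

noncomputable section

open Set Filter Function Topology
open scoped Manifold ContDiff

namespace Literature.Analysis.FunctionSpaces

namespace LatticePU

variable {E : Type*} [NormedAddCommGroup E] [NormedSpace ℝ E] {ι : Type*}

/-! ### The one-variable plateau function -/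

/-- The plateau function `η_δ`: smooth, `= 1` on `[0, 1]`, `= 0` off `(-δ, 1 + δ)`, values in
`[0, 1]`. [folklore] -/
def plateau (δ : ℝ) (s : ℝ) : ℝ :=
  Real.smoothTransition ((s + δ) / δ) * Real.smoothTransition ((1 + δ - s) / δ)

section Plateau

variable {δ : ℝ}

/-- The plateau function is smooth. [folklore] -/
theorem contDiff_plateau (δ : ℝ) {n : ℕ∞} : ContDiff ℝ n (plateau δ) := by
  unfold plateau
  exact (Real.smoothTransition.contDiff.comp ((contDiff_id.add contDiff_const).div_const _)).mul
    (Real.smoothTransition.contDiff.comp ((contDiff_const.sub contDiff_id).div_const _))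

/-- The plateau function is non-negative. [folklore] -/
theorem plateau_nonneg (δ s : ℝ) : 0 ≤ plateau δ s :=
  mul_nonneg (Real.smoothTransition.nonneg _) (Real.smoothTransition.nonneg _)

/-- The plateau function is at most `1`. [folklore] -/
theorem plateau_le_one (δ s : ℝ) : plateau δ s ≤ 1 :=
  mul_le_one₀ (Real.smoothTransition.le_one _) (Real.smoothTransition.nonneg _)
    (Real.smoothTransition.le_one _)

/-- The plateau function is `1` on `[0, 1]`. [folklore] -/
theorem plateau_eq_one (hδ : 0 < δ) {s : ℝ} (hs : s ∈ Icc (0 : ℝ) 1) : plateau δ s = 1 := by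
  unfold plateau
  rw [Real.smoothTransition.one_of_one_le, Real.smoothTransition.one_of_one_le, mul_one]
  · rw [le_div_iff₀ hδ]; linarith [hs.2]
  · rw [le_div_iff₀ hδ]; linarith [hs.1]

/-- The plateau function vanishes for `s ≤ -δ`. [folklore] -/
theorem plateau_eq_zero_of_le (hδ : 0 < δ) {s : ℝ} (hs : s ≤ -δ) : plateau δ s = 0 := by
  unfold plateau
  rw [Real.smoothTransition.zero_of_nonpos, zero_mul]
  rw [div_nonpos_iff]; exact Or.inr ⟨by linarith, hδ.le⟩

/-- The plateau function vanishes for `1 + δ ≤ s`. [folklore] -/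
theorem plateau_eq_zero_of_ge (hδ : 0 < δ) {s : ℝ} (hs : 1 + δ ≤ s) : plateau δ s = 0 := by
  unfold plateau
  rw [Real.smoothTransition.zero_of_nonpos (x := (1 + δ - s) / δ), mul_zero]
  rw [div_nonpos_iff]; exact Or.inr ⟨by linarith, hδ.le⟩

/-- Where the plateau function is non-zero, the argument lies in `(-δ, 1 + δ)`. [folklore] -/
theorem mem_Ioo_of_plateau_ne_zero (hδ : 0 < δ) {s : ℝ} (hs : plateau δ s ≠ 0) :
    s ∈ Ioo (-δ) (1 + δ) := by
  constructor
  · by_contra h; exact hs (plateau_eq_zero_of_le hδ (not_lt.1 h))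
  · by_contra h; exact hs (plateau_eq_zero_of_ge hδ (not_lt.1 h))

end Plateau

/-! ### Lattice vectors and coordinates -/

variable (Ψ : (ι → ℝ) ≃L[ℝ] E)

/-- The lattice vector with integer coordinates `n`. [folklore] -/
def latVec (n : ι → ℤ) : E := Ψ fun i => (n i : ℝ)

/-- The lattice coordinates of a point. [folklore] -/
def coord (x : E) : ι → ℝ := Ψ.symm x

/-- Coordinates of a difference with a lattice vector. [folklore] -/
theorem coord_sub_latVec (x : E) (n : ι → ℤ) (i : ι) :
    coord Ψ (x - latVec Ψ n) i = coord Ψ x i - n i := by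
  simp [coord, latVec]

/-- Coordinates of a sum with a lattice vector. [folklore] -/
theorem coord_add_latVec (x : E) (n : ι → ℤ) (i : ι) :
    coord Ψ (x + latVec Ψ n) i = coord Ψ x i + n i := by
  simp [coord, latVec]

/-- Lattice vectors are additive. [folklore] -/
theorem latVec_add (n m : ι → ℤ) : latVec Ψ (n + m) = latVec Ψ n + latVec Ψ m := by
  simp only [latVec, ← map_add]; congr 1; funext i; simp

/-- The zero lattice vector. [folklore] -/
@[simp] theorem latVec_zero : latVec Ψ (0 : ι → ℤ) = 0 := by
  simp only [latVec, Pi.zero_apply, Int.cast_zero]; exact map_zero Ψ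

/-- Negation of lattice vectors. [folklore] -/
theorem latVec_neg (n : ι → ℤ) : latVec Ψ (-n) = -latVec Ψ n := by
  simp only [latVec, ← map_neg]; congr 1; funext i; simp

/-- The coordinate map is continuous. [folklore] -/
theorem continuous_coord : Continuous (coord Ψ) := Ψ.symm.continuous

variable [Fintype ι]

/-- The coordinate functions are smooth. [folklore] -/
theorem contDiff_coord_apply (i : ι) {n : ℕ∞} : ContDiff ℝ n fun x => coord Ψ x i :=
  (contDiff_apply ℝ ℝ i).comp Ψ.symm.contDiff

/-! ### The cell bump -/

/-- The **cell bump** `b (x) = Π_i η_δ (y_i (x) - c_i)`: smooth, values in `[0, 1]`, `= 1` on the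
closed cell `{y - c ∈ [0, 1]^ι}` and `= 0` off the `δ`-enlarged open cell. [folklore] -/
def cellBump (c : ι → ℝ) (δ : ℝ) (x : E) : ℝ := ∏ i, plateau δ (coord Ψ x i - c i)

section CellBump

variable {Ψ} {c : ι → ℝ} {δ : ℝ}

/-- The cell bump is smooth. [folklore] -/
theorem contDiff_cellBump (c : ι → ℝ) (δ : ℝ) {n : ℕ∞} : ContDiff ℝ n (cellBump Ψ c δ) :=
  contDiff_prod fun i _ => (contDiff_plateau δ).comp ((contDiff_coord_apply Ψ i).sub contDiff_const)

/-- The cell bump is non-negative. [folklore] -/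
theorem cellBump_nonneg (x : E) : 0 ≤ cellBump Ψ c δ x :=
  Finset.prod_nonneg fun _ _ => plateau_nonneg _ _

/-- The cell bump is at most `1`. [folklore] -/
theorem cellBump_le_one (x : E) : cellBump Ψ c δ x ≤ 1 :=
  Finset.prod_le_one (fun _ _ => plateau_nonneg _ _) fun _ _ => plateau_le_one _ _

/-- The cell bump is `1` on the closed cell. [folklore] -/
theorem cellBump_eq_one (hδ : 0 < δ) {x : E} (hx : ∀ i, coord Ψ x i - c i ∈ Icc (0 : ℝ) 1) :
    cellBump Ψ c δ x = 1 :=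
  Finset.prod_eq_one fun i _ => plateau_eq_one hδ (hx i)

/-- Where the cell bump is non-zero, all shifted coordinates lie in `(-δ, 1 + δ)`. [folklore] -/
theorem mem_Ioo_of_cellBump_ne_zero (hδ : 0 < δ) {x : E} (hx : cellBump Ψ c δ x ≠ 0) (i : ι) :
    coord Ψ x i - c i ∈ Ioo (-δ) (1 + δ) :=
  mem_Ioo_of_plateau_ne_zero hδ fun h => hx (Finset.prod_eq_zero (Finset.mem_univ i) h)

/-- The cell bump vanishes as soon as one shifted coordinate leaves `(-δ, 1 + δ)`. [folklore] -/
theorem cellBump_eq_zero (hδ : 0 < δ) {x : E} {i : ι} (hx : coord Ψ x i - c i ∉ Ioo (-δ) (1 + δ)) :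
    cellBump Ψ c δ x = 0 := by
  by_contra h
  exact hx (mem_Ioo_of_cellBump_ne_zero hδ h i)

/-- The support of the cell bump lies in the image of a compact box of coordinates. [folklore] -/
theorem tsupport_cellBump_subset (hδ : 0 < δ) :
    tsupport (cellBump Ψ c δ) ⊆ Ψ '' Set.pi univ fun i => Icc (c i - δ) (c i + 1 + δ) := by
  have hcl : IsClosed (Ψ '' Set.pi univ fun i => Icc (c i - δ) (c i + 1 + δ)) :=
    ((isCompact_univ_pi fun i => isCompact_Icc).image Ψ.continuous).isClosed
  refine closure_minimal (fun x hx => ?_) hcl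
  refine ⟨coord Ψ x, fun i _ => ?_, by simp [coord]⟩
  have h := mem_Ioo_of_cellBump_ne_zero hδ hx i
  exact ⟨by linarith [h.1], by linarith [h.2]⟩

/-- The cell bump has compact support. [folklore] -/
theorem hasCompactSupport_cellBump (hδ : 0 < δ) : HasCompactSupport (cellBump Ψ c δ) :=
  ((isCompact_univ_pi fun _ => isCompact_Icc).image Ψ.continuous).of_isClosed_subset
    (isClosed_tsupport _) (tsupport_cellBump_subset hδ)

end CellBump


/-! ### Lattice sums: finiteness and local finiteness -/

section LatticeSum

variable {Ψ} {c : ι → ℝ} {δ : ℝ}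

/-- **Integer points in a bounded coordinate box are finite.** [folklore] -/
theorem finite_setOf_forall_mem_Ioo (a b : ι → ℝ) :
    {n : ι → ℤ | ∀ i, (n i : ℝ) ∈ Ioo (a i) (b i)}.Finite := by
  refine (Set.Finite.pi (t := fun i => Icc ⌊a i⌋ ⌈b i⌉) fun i => Set.finite_Icc _ _).subset ?_
  intro n hn i _
  obtain ⟨h1, h2⟩ := hn i
  exact ⟨(Int.floor_le_floor h1.le).trans_eq (Int.floor_intCast _),
    (Int.ceil_intCast (n i)).symm.trans_le (Int.ceil_le_ceil h2.le)⟩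

/-- The lattice vectors `n` for which the translated cell bump `b (x - Ψ n)` can be non-zero at a
point whose coordinates are within `r` of those of `x₀`: a finite set. [folklore] -/
theorem finite_setOf_cellBump_translate_ne_zero (hδ : 0 < δ) (x₀ : E) (r : ℝ) :
    {n : ι → ℤ | ∃ x : E, (∀ i, |coord Ψ x i - coord Ψ x₀ i| < r) ∧
      cellBump Ψ c δ (x - latVec Ψ n) ≠ 0}.Finite := by
  refine (finite_setOf_forall_mem_Ioo (fun i => coord Ψ x₀ i - c i - 1 - δ - r)
    (fun i => coord Ψ x₀ i - c i + δ + r)).subset ?_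
  rintro n ⟨x, hx, hne⟩ i
  have h := mem_Ioo_of_cellBump_ne_zero hδ hne i
  rw [coord_sub_latVec] at h
  have hxi := abs_lt.1 (hx i)
  constructor
  · change coord Ψ x₀ i - c i - 1 - δ - r < (n i : ℝ); linarith [h.2]
  · change (n i : ℝ) < coord Ψ x₀ i - c i + δ + r; linarith [h.1]

/-- **Local finiteness** of the family of supports of the translated cell bumps. [folklore] -/
theorem locallyFinite_support_cellBump_translate (hδ : 0 < δ) :
    LocallyFinite fun n : ι → ℤ => support fun x => cellBump Ψ c δ (x - latVec Ψ n) := by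
  intro x₀
  set U : Set E := {x | ∀ i, |coord Ψ x i - coord Ψ x₀ i| < 1} with hU
  have hUo : IsOpen U := by
    rw [hU]
    simp only [setOf_forall]
    exact isOpen_iInter_of_finite fun i => isOpen_lt
      (((continuous_apply i).comp (continuous_coord Ψ)).sub continuous_const).abs continuous_const
  have hx₀ : x₀ ∈ U := fun i => by simp
  refine ⟨U, hUo.mem_nhds hx₀, ?_⟩
  refine (finite_setOf_cellBump_translate_ne_zero (Ψ := Ψ) (c := c) hδ x₀ 1).subset ?_
  rintro n ⟨x, hxs, hxU⟩
  exact ⟨x, hxU, hxs⟩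

/-- For each point, only finitely many translated cell bumps are non-zero. [folklore] -/
theorem finite_support_cellBump_translate (hδ : 0 < δ) (x : E) :
    (support fun n : ι → ℤ => cellBump Ψ c δ (x - latVec Ψ n)).Finite := by
  refine (finite_setOf_cellBump_translate_ne_zero (Ψ := Ψ) (c := c) hδ x 1).subset fun n hn => ?_
  exact ⟨x, fun i => by simp, hn⟩

/-! ### The lattice sum `S = Σ_n b (· - Ψ n)` -/

/-- The **lattice sum** of the cell bump, `S (x) = Σ_{n ∈ ℤ^ι} b (x - Ψ n)`. [folklore] -/
def cellSum (Ψ : (ι → ℝ) ≃L[ℝ] E) (c : ι → ℝ) (δ : ℝ) (x : E) : ℝ :=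
  ∑ᶠ n : ι → ℤ, cellBump Ψ c δ (x - latVec Ψ n)

/-- **The lattice sum is smooth** (a locally finite sum of smooth functions). [folklore] -/
theorem contDiff_cellSum [FiniteDimensional ℝ E] (hδ : 0 < δ) {m : ℕ∞} :
    ContDiff ℝ m (cellSum Ψ c δ) := by
  have h : ∀ n : ι → ℤ, ContDiff ℝ m fun x => cellBump Ψ c δ (x - latVec Ψ n) := fun n =>
    (contDiff_cellBump c δ).comp (contDiff_id.sub contDiff_const)
  have hm : ContMDiff 𝓘(ℝ, E) 𝓘(ℝ, ℝ) m (cellSum Ψ c δ) :=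
    contMDiff_finsum (fun n => contMDiff_iff_contDiff.2 (h n))
      (locallyFinite_support_cellBump_translate hδ)
  exact contMDiff_iff_contDiff.1 hm

/-- The lattice sum is at least `1`: the cell containing `x` contributes `1`. [folklore] -/
theorem one_le_cellSum (hδ : 0 < δ) (x : E) : 1 ≤ cellSum Ψ c δ x := by
  set n₀ : ι → ℤ := fun i => ⌊coord Ψ x i - c i⌋ with hn₀
  have h1 : cellBump Ψ c δ (x - latVec Ψ n₀) = 1 := by
    refine cellBump_eq_one hδ fun i => ?_
    rw [coord_sub_latVec]
    exact ⟨by have := Int.floor_le (coord Ψ x i - c i); simp only [hn₀]; linarith,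
      by have := Int.lt_floor_add_one (coord Ψ x i - c i); simp only [hn₀]; linarith⟩
  rw [cellSum, ← h1]
  exact single_le_finsum n₀ (finite_support_cellBump_translate hδ x) fun n => cellBump_nonneg _

/-- The lattice sum is positive. [folklore] -/
theorem cellSum_pos (hδ : 0 < δ) (x : E) : 0 < cellSum Ψ c δ x :=
  lt_of_lt_of_le one_pos (one_le_cellSum hδ x)

/-- **The lattice sum is `Λ`-periodic.** [folklore] -/
theorem cellSum_sub_latVec (m : ι → ℤ) (x : E) : cellSum Ψ c δ (x - latVec Ψ m) = cellSum Ψ c δ x := by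
  unfold cellSum
  conv_rhs => rw [← finsum_comp_equiv (Equiv.addRight m)]
  refine finsum_congr fun n => ?_
  simp only [Equiv.coe_addRight, latVec_add, sub_sub, add_comm]

/-- The lattice sum is `Λ`-periodic (additive form). [folklore] -/
theorem cellSum_add_latVec (m : ι → ℤ) (x : E) : cellSum Ψ c δ (x + latVec Ψ m) = cellSum Ψ c δ x := by
  have h := cellSum_sub_latVec (Ψ := Ψ) (c := c) (δ := δ) m (x + latVec Ψ m)
  rw [add_sub_cancel_right] at h
  exact h.symm

/-! ### The lattice partition of unity -/

/-- **The lattice partition of unity** adapted to the cell with corner `c`: `χ = b / S`.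
[folklore] -/
def cellPU (Ψ : (ι → ℝ) ≃L[ℝ] E) (c : ι → ℝ) (δ : ℝ) (x : E) : ℝ :=
  cellBump Ψ c δ x / cellSum Ψ c δ x

/-- The lattice partition of unity is smooth. [folklore] -/
theorem contDiff_cellPU [FiniteDimensional ℝ E] (hδ : 0 < δ) {m : ℕ∞} : ContDiff ℝ m (cellPU Ψ c δ) :=
  (contDiff_cellBump c δ).div (contDiff_cellSum hδ) fun x => (cellSum_pos hδ x).ne'

/-- The lattice partition of unity is non-negative. [folklore] -/
theorem cellPU_nonneg (hδ : 0 < δ) (x : E) : 0 ≤ cellPU Ψ c δ x :=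
  div_nonneg (cellBump_nonneg x) (cellSum_pos hδ x).le

/-- The lattice partition of unity is at most `1`. [folklore] -/
theorem cellPU_le_one (hδ : 0 < δ) (x : E) : cellPU Ψ c δ x ≤ 1 := by
  rw [cellPU, div_le_one (cellSum_pos hδ x), cellSum]
  have h := single_le_finsum (0 : ι → ℤ) (finite_support_cellBump_translate hδ x)
    fun n => cellBump_nonneg (Ψ := Ψ) (c := c) (δ := δ) (x - latVec Ψ n)
  simpa using h

/-- The support of the lattice partition of unity is that of the cell bump. [folklore] -/
theorem tsupport_cellPU_subset (hδ : 0 < δ) :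
    tsupport (cellPU Ψ c δ) ⊆ Ψ '' Set.pi univ fun i => Icc (c i - δ) (c i + 1 + δ) := by
  refine (closure_mono fun x hx => ?_).trans (tsupport_cellBump_subset hδ)
  intro h0
  exact hx (by simp [cellPU, h0])

/-- The lattice partition of unity has compact support. [folklore] -/
theorem hasCompactSupport_cellPU (hδ : 0 < δ) : HasCompactSupport (cellPU Ψ c δ) :=
  ((isCompact_univ_pi fun _ => isCompact_Icc).image Ψ.continuous).of_isClosed_subset
    (isClosed_tsupport _) (tsupport_cellPU_subset hδ)

/-- For each point, only finitely many translates of `χ` are non-zero. [folklore] -/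
theorem finite_support_cellPU_translate (hδ : 0 < δ) (x : E) :
    (support fun n : ι → ℤ => cellPU Ψ c δ (x - latVec Ψ n)).Finite := by
  refine (finite_support_cellBump_translate (Ψ := Ψ) (c := c) hδ x).subset fun n hn => ?_
  intro h0
  exact hn (by simp [cellPU, h0])

/-- **`Σ_n χ (x - Ψ n) = 1`.** [folklore] -/
theorem finsum_cellPU_sub_latVec (hδ : 0 < δ) (x : E) :
    ∑ᶠ n : ι → ℤ, cellPU Ψ c δ (x - latVec Ψ n) = 1 := by
  simp only [cellPU, cellSum_sub_latVec, div_eq_mul_inv]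
  rw [← finsum_mul' _ _ (finite_support_cellBump_translate hδ x)]
  exact mul_inv_cancel₀ (cellSum_pos hδ x).ne'

/-- **`Σ_n χ (x + Ψ n) = 1`** (the same, summed over `-n`). [folklore] -/
theorem finsum_cellPU_add_latVec (hδ : 0 < δ) (x : E) :
    ∑ᶠ n : ι → ℤ, cellPU Ψ c δ (x + latVec Ψ n) = 1 := by
  rw [← finsum_cellPU_sub_latVec (c := c) hδ x,
    ← finsum_comp_equiv (Equiv.neg (ι → ℤ)) (f := fun n => cellPU Ψ c δ (x - latVec Ψ n))]
  refine finsum_congr fun n => ?_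
  simp only [Equiv.neg_apply, latVec_neg, sub_neg_eq_add]

/-! ### The core of the cell -/

/-- The **core** of the cell with corner `c`: coordinates minus `c` in `(2δ, 1 - 2δ)`. [folklore] -/
def core (Ψ : (ι → ℝ) ≃L[ℝ] E) (c : ι → ℝ) (δ : ℝ) : Set E :=
  {x | ∀ i, coord Ψ x i - c i ∈ Ioo (2 * δ) (1 - 2 * δ)}

/-- The core is open. [folklore] -/
theorem isOpen_core : IsOpen (core Ψ c δ) := by
  simp only [core, setOf_forall]
  exact isOpen_iInter_of_finite fun i => isOpen_Ioo.preimage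
    (((continuous_apply i).comp (continuous_coord Ψ)).sub continuous_const)

/-- On the core, the only non-zero translate of the cell bump is the untranslated one: the
lattice sum is `1` there. [folklore] -/
theorem cellSum_eq_one_of_mem_core (hδ : 0 < δ) {x : E} (hx : x ∈ core Ψ c δ) :
    cellSum Ψ c δ x = 1 := by
  have hb : cellBump Ψ c δ x = 1 := cellBump_eq_one hδ fun i => by
    have := hx i; exact ⟨by linarith [this.1], by linarith [this.2]⟩
  have hzero : ∀ n : ι → ℤ, n ≠ 0 → cellBump Ψ c δ (x - latVec Ψ n) = 0 := by
    intro n hn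
    obtain ⟨i, hi⟩ : ∃ i, n i ≠ 0 := by
      by_contra h; push Not at h; exact hn (funext h)
    refine cellBump_eq_zero hδ (i := i) ?_
    rw [coord_sub_latVec]
    have hxi := hx i
    rcases lt_or_gt_of_ne hi with hlt | hgt
    · have : (n i : ℝ) ≤ -1 := by exact_mod_cast Int.le_sub_one_iff.2 hlt
      intro h; linarith [h.2, hxi.1]
    · have : (1 : ℝ) ≤ n i := by exact_mod_cast hgt
      intro h; linarith [h.1, hxi.2]
  rw [cellSum, finsum_eq_single _ (0 : ι → ℤ) hzero, latVec_zero, sub_zero, hb]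

/-- **`χ = 1` on the core.** [folklore] -/
theorem cellPU_eq_one_of_mem_core (hδ : 0 < δ) {x : E} (hx : x ∈ core Ψ c δ) :
    cellPU Ψ c δ x = 1 := by
  have hb : cellBump Ψ c δ x = 1 := cellBump_eq_one hδ fun i => by
    have := hx i; exact ⟨by linarith [this.1], by linarith [this.2]⟩
  rw [cellPU, cellSum_eq_one_of_mem_core hδ hx, hb, div_one]

/-- **`χ = 0` on the non-trivial lattice translates of the core.** [folklore] -/
theorem cellPU_eq_zero_of_mem_core_add (hδ : 0 < δ) {x : E} (hx : x ∈ core Ψ c δ)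
    {n : ι → ℤ} (hn : n ≠ 0) : cellPU Ψ c δ (x + latVec Ψ n) = 0 := by
  obtain ⟨i, hi⟩ : ∃ i, n i ≠ 0 := by
    by_contra h; push Not at h; exact hn (funext h)
  have hb : cellBump Ψ c δ (x + latVec Ψ n) = 0 := by
    refine cellBump_eq_zero hδ (i := i) ?_
    rw [coord_add_latVec]
    have hxi := hx i
    rcases lt_or_gt_of_ne hi with hlt | hgt
    · have : (n i : ℝ) ≤ -1 := by exact_mod_cast Int.le_sub_one_iff.2 hlt
      intro h; linarith [h.1, hxi.2]
    · have : (1 : ℝ) ≤ n i := by exact_mod_cast hgt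
      intro h; linarith [h.2, hxi.1]
  simp [cellPU, hb]

/-- The translates of the core are open. [folklore] -/
theorem isOpen_core_add (n : ι → ℤ) : IsOpen ((· + latVec Ψ n) '' core Ψ c δ) :=
  (Homeomorph.addRight (latVec Ψ n)).isOpenMap _ isOpen_core

/-- `χ` vanishes identically near a non-trivial lattice translate of a core point. [folklore] -/
theorem cellPU_eventuallyEq_zero (hδ : 0 < δ) {x : E} (hx : x ∈ core Ψ c δ) {n : ι → ℤ} (hn : n ≠ 0) :
    cellPU Ψ c δ =ᶠ[𝓝 (x + latVec Ψ n)] fun _ => 0 := by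
  have hmem : x + latVec Ψ n ∈ (· + latVec Ψ n) '' core Ψ c δ := ⟨x, hx, rfl⟩
  filter_upwards [(isOpen_core_add n).mem_nhds hmem] with y hy
  obtain ⟨y₀, hy₀, rfl⟩ := hy
  exact cellPU_eq_zero_of_mem_core_add hδ hy₀ hn

/-- `χ` is identically `1` near a core point. [folklore] -/
theorem cellPU_eventuallyEq_one (hδ : 0 < δ) {x : E} (hx : x ∈ core Ψ c δ) :
    cellPU Ψ c δ =ᶠ[𝓝 x] fun _ => 1 := by
  filter_upwards [isOpen_core.mem_nhds hx] with y hy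
  exact cellPU_eq_one_of_mem_core hδ hy

end LatticeSum


/-! ### Derivatives of the translates sum to zero -/

section Deriv

variable {Ψ} {c : ι → ℝ} {δ : ℝ}

/-- Near `x`, only the translates indexed by a fixed finite set can be non-zero. [folklore] -/
theorem exists_finset_cellPU_translate_eq_zero (hδ : 0 < δ) (x : E) :
    ∃ (N : Finset (ι → ℤ)) (U : Set E), IsOpen U ∧ x ∈ U ∧
      ∀ y ∈ U, ∀ n, n ∉ N → cellPU Ψ c δ (y - latVec Ψ n) = 0 := by
  set U : Set E := {y | ∀ i, |coord Ψ y i - coord Ψ x i| < 1} with hU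
  have hUo : IsOpen U := by
    rw [hU]; simp only [setOf_forall]
    exact isOpen_iInter_of_finite fun i => isOpen_lt
      (((continuous_apply i).comp (continuous_coord Ψ)).sub continuous_const).abs continuous_const
  refine ⟨(finite_setOf_cellBump_translate_ne_zero (Ψ := Ψ) (c := c) hδ x 1).toFinset, U, hUo,
    fun i => by simp, fun y hy n hn => ?_⟩
  have hb : cellBump Ψ c δ (y - latVec Ψ n) = 0 := by
    by_contra h
    exact hn ((Set.Finite.mem_toFinset _).2 ⟨y, hy, h⟩)
  simp [cellPU, hb]

/-- **The derivatives of the translates of `χ` sum to zero**: `Σ_n D χ (x - Ψ n) v = 0`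
(differentiate `Σ_n χ (x - Ψ n) = 1`, a locally finite sum). [folklore] -/
theorem finsum_fderiv_cellPU_sub_latVec_apply [FiniteDimensional ℝ E] (hδ : 0 < δ) (x : E) (v : E) :
    ∑ᶠ n : ι → ℤ, fderiv ℝ (cellPU Ψ c δ) (x - latVec Ψ n) v = 0 := by
  classical
  obtain ⟨N, U, hUo, hxU, hN⟩ := exists_finset_cellPU_translate_eq_zero (Ψ := Ψ) (c := c) hδ x
  have hd : Differentiable ℝ (cellPU Ψ c δ) := (contDiff_cellPU hδ (m := 1)).differentiable one_ne_zero
  -- on `U`, the full sum is the finite sum over `N`, and it is `1`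
  have hloc : (fun y => ∑ n ∈ N, cellPU Ψ c δ (y - latVec Ψ n)) =ᶠ[𝓝 x] fun _ => 1 := by
    filter_upwards [hUo.mem_nhds hxU] with y hy
    rw [← finsum_cellPU_sub_latVec (c := c) hδ y]
    refine (finsum_eq_sum_of_support_subset _ fun n hn => ?_).symm
    by_contra hnN
    exact hn (hN y hy n hnN)
  have hderiv : fderiv ℝ (fun y => ∑ n ∈ N, cellPU Ψ c δ (y - latVec Ψ n)) x = 0 := by
    rw [hloc.fderiv_eq]; exact fderiv_const_apply _
  have hdiff : ∀ n ∈ N, DifferentiableAt ℝ (fun y => cellPU Ψ c δ (y - latVec Ψ n)) x := fun n _ =>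
    (hd _).comp x (differentiableAt_id.sub_const _)
  rw [fderiv_fun_sum hdiff] at hderiv
  -- translates outside `N` vanish near `x - Ψ n`, so their derivative there is `0`
  have hzero : ∀ n, n ∉ N → fderiv ℝ (cellPU Ψ c δ) (x - latVec Ψ n) = 0 := by
    intro n hn
    have hev : cellPU Ψ c δ =ᶠ[𝓝 (x - latVec Ψ n)] fun _ => 0 := by
      have hmem : x - latVec Ψ n ∈ (· - latVec Ψ n) '' U := ⟨x, hxU, rfl⟩
      have hopen : IsOpen ((· - latVec Ψ n) '' U) := (Homeomorph.subRight (latVec Ψ n)).isOpenMap _ hUo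
      filter_upwards [hopen.mem_nhds hmem] with y hy
      obtain ⟨y₀, hy₀, rfl⟩ := hy
      exact hN y₀ hy₀ n hn
    rw [hev.fderiv_eq]; exact fderiv_const_apply _
  rw [finsum_eq_sum_of_support_subset _ (s := N) fun n hn => ?_]
  · have h := congrArg (fun L : E →L[ℝ] ℝ => L v) hderiv
    simp only [zero_apply] at h
    rw [← h, _root_.sum_apply]
    refine Finset.sum_congr rfl fun n _ => ?_
    rw [fderiv_comp_sub]
  · by_contra hnN
    exact hn (by simp [hzero n hnN])

end Deriv

/-! ### Placing finitely many points in the core: generic corners -/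

section Generic

variable {Ψ}

/-- **One coordinate at a time**: for finitely many reals `a ∈ A` and `0 < δ` with
`12 δ |A| < 1`, some `c ∈ [0, 1]` has `|a - c - m| > 2δ` for all `a ∈ A` and all integers `m`
(the forbidden set has measure `≤ 12 δ |A| < 1`). [folklore] -/
theorem exists_forall_abs_sub_sub_int_gt (A : Finset ℝ) {δ : ℝ} (hδ : 0 < δ) (hA : 12 * δ * A.card < 1) :
    ∃ c ∈ Icc (0 : ℝ) 1, ∀ a ∈ A, ∀ m : ℤ, 2 * δ < |a - c - m| := by
  classical
  -- the forbidden set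
  set F : Set ℝ := ⋃ a ∈ A, ⋃ m ∈ ({⌊a⌋ - 1, ⌊a⌋, ⌊a⌋ + 1} : Finset ℤ),
    Icc (a - m - 2 * δ) (a - m + 2 * δ) with hF
  have hFvol : MeasureTheory.volume F ≤ ENNReal.ofReal (12 * δ * A.card) := by
    refine (MeasureTheory.measure_biUnion_finset_le _ _).trans ?_
    have hterm : ∀ a ∈ A, MeasureTheory.volume (⋃ m ∈ ({⌊a⌋ - 1, ⌊a⌋, ⌊a⌋ + 1} : Finset ℤ),
        Icc (a - m - 2 * δ) (a - m + 2 * δ)) ≤ ENNReal.ofReal (12 * δ) := by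
      intro a _
      refine (MeasureTheory.measure_biUnion_finset_le _ _).trans ?_
      calc ∑ m ∈ ({⌊a⌋ - 1, ⌊a⌋, ⌊a⌋ + 1} : Finset ℤ), MeasureTheory.volume (Icc (a - m - 2 * δ) (a - m + 2 * δ))
          = ∑ _m ∈ ({⌊a⌋ - 1, ⌊a⌋, ⌊a⌋ + 1} : Finset ℤ), ENNReal.ofReal (4 * δ) := by
            refine Finset.sum_congr rfl fun m _ => ?_
            rw [Real.volume_Icc]; congr 1; ring
        _ ≤ 3 * ENNReal.ofReal (4 * δ) := by
            rw [Finset.sum_const, nsmul_eq_mul]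
            gcongr
            exact_mod_cast Finset.card_le_three
        _ = ENNReal.ofReal (12 * δ) := by
            rw [show (3 : ENNReal) = ENNReal.ofReal 3 by norm_num, ← ENNReal.ofReal_mul (by norm_num)]
            congr 1; ring
    calc ∑ a ∈ A, MeasureTheory.volume (⋃ m ∈ ({⌊a⌋ - 1, ⌊a⌋, ⌊a⌋ + 1} : Finset ℤ),
          Icc (a - m - 2 * δ) (a - m + 2 * δ))
        ≤ ∑ _a ∈ A, ENNReal.ofReal (12 * δ) := Finset.sum_le_sum hterm
      _ = ENNReal.ofReal (12 * δ * A.card) := by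
          rw [Finset.sum_const, nsmul_eq_mul, ← ENNReal.ofReal_natCast, ← ENNReal.ofReal_mul (by norm_num)]
          congr 1; ring
  -- `[0, 1]` is not covered
  have hnot : ¬ (Icc (0 : ℝ) 1 ⊆ F) := by
    intro hsub
    have h1 : MeasureTheory.volume (Icc (0 : ℝ) 1) ≤ MeasureTheory.volume F := MeasureTheory.measure_mono hsub
    rw [Real.volume_Icc, sub_zero, ENNReal.ofReal_one] at h1
    have h2 := h1.trans hFvol
    rw [← ENNReal.ofReal_one, ENNReal.ofReal_le_ofReal_iff (by positivity)] at h2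
    linarith
  obtain ⟨c, hc, hcF⟩ := not_subset.1 hnot
  refine ⟨c, hc, fun a ha m => ?_⟩
  by_contra hle
  rw [not_lt] at hle
  -- then `m` is one of the three integers near `⌊a⌋`, contradiction with `c ∉ F`
  have hmem3 : m ∈ ({⌊a⌋ - 1, ⌊a⌋, ⌊a⌋ + 1} : Finset ℤ) := by
    have hδ1 : 2 * δ < 1 := by
      have : (1 : ℝ) ≤ A.card := by exact_mod_cast Finset.card_pos.2 ⟨a, ha⟩
      nlinarith
    have h1 := abs_le.1 hle
    have hfl := Int.floor_le a
    have hfl' := Int.lt_floor_add_one a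
    have hm1 : (⌊a⌋ : ℝ) - 1 ≤ m := by
      by_contra h; push Not at h
      have : (m : ℝ) ≤ ⌊a⌋ - 2 := by
        have : m ≤ ⌊a⌋ - 2 := by
          have : m < ⌊a⌋ - 1 := by exact_mod_cast h
          omega
        exact_mod_cast this
      linarith [hc.2]
    have hm2 : (m : ℝ) ≤ ⌊a⌋ + 1 := by
      by_contra h; push Not at h
      have : (⌊a⌋ : ℝ) + 2 ≤ m := by
        have : ⌊a⌋ + 2 ≤ m := by
          have : ⌊a⌋ + 1 < m := by exact_mod_cast h
          omega
        exact_mod_cast this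
      linarith [hc.1]
    have : m = ⌊a⌋ - 1 ∨ m = ⌊a⌋ ∨ m = ⌊a⌋ + 1 := by
      have h3 : ⌊a⌋ - 1 ≤ m := by exact_mod_cast hm1
      have h4 : m ≤ ⌊a⌋ + 1 := by exact_mod_cast hm2
      omega
    simp only [Finset.mem_insert, Finset.mem_singleton]
    tauto
  refine hcF (mem_biUnion ha (mem_biUnion hmem3 ?_))
  have h1 := abs_le.1 hle
  exact ⟨by linarith, by linarith⟩

/-- From `|a - c - m| > 2δ` for all integers `m`: the fractional part of `a - c` lies in
`(2δ, 1 - 2δ)`. [folklore] -/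
theorem fract_mem_Ioo_of_forall_abs_gt {a c δ : ℝ} (h : ∀ m : ℤ, 2 * δ < |a - c - m|) :
    Int.fract (a - c) ∈ Ioo (2 * δ) (1 - 2 * δ) := by
  have h0 := Int.fract_nonneg (a - c)
  have h1 := Int.fract_lt_one (a - c)
  have hfl : Int.fract (a - c) = a - c - ⌊a - c⌋ := Int.fract.eq_1 _  -- `fract x = x - ⌊x⌋`
  constructor
  · have := h ⌊a - c⌋
    rw [← hfl, abs_of_nonneg h0] at this
    exact this
  · have := h (⌊a - c⌋ + 1)
    push_cast at this
    rw [show a - c - (⌊a - c⌋ + 1) = Int.fract (a - c) - 1 by rw [hfl]; ring,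
      abs_of_nonpos (by linarith)] at this
    linarith

omit [Fintype ι] in
/-- **Generic corners.** For finitely many points `P` there are `δ ∈ (0, 1/4]` and a corner `c`
such that every point of `P`, reduced to the cell with corner `c`, lies in the core: all its
coordinates minus `c` have fractional part in `(2δ, 1 - 2δ)`. [folklore] -/
theorem exists_corner (P : Finset E) :
    ∃ δ : ℝ, 0 < δ ∧ δ ≤ 1 / 4 ∧ ∃ c : ι → ℝ,
      ∀ p ∈ P, ∀ i, Int.fract (coord Ψ p i - c i) ∈ Ioo (2 * δ) (1 - 2 * δ) := by
  classical
  set δ : ℝ := 1 / (16 * (P.card + 1)) with hδ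
  have hδ0 : 0 < δ := by positivity
  have hδ4 : δ ≤ 1 / 4 := by
    rw [hδ, div_le_div_iff₀ (by positivity) (by norm_num)]
    have : (0 : ℝ) ≤ P.card := by positivity
    nlinarith
  have hcoord : ∀ i, ∃ c ∈ Icc (0 : ℝ) 1, ∀ a ∈ P.image (fun p => coord Ψ p i), ∀ m : ℤ, 2 * δ < |a - c - m| := by
    intro i
    refine exists_forall_abs_sub_sub_int_gt _ hδ0 ?_
    have hcard : ((P.image fun p => coord Ψ p i).card : ℝ) ≤ P.card := by exact_mod_cast Finset.card_image_le
    have hP : (0 : ℝ) ≤ P.card := by positivity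
    have hk : (0 : ℝ) ≤ (P.image fun p => coord Ψ p i).card := by positivity
    rw [hδ]
    have h16 : (0 : ℝ) < 16 * (P.card + 1) := by positivity
    calc 12 * (1 / (16 * ((P.card : ℝ) + 1))) * ((P.image fun p => coord Ψ p i).card : ℝ)
        ≤ 12 * (1 / (16 * ((P.card : ℝ) + 1))) * P.card := by gcongr
      _ = 12 * P.card / (16 * (P.card + 1)) := by ring
      _ < 1 := by rw [div_lt_one h16]; nlinarith
  choose c hc01 hc using hcoord
  refine ⟨δ, hδ0, hδ4, c, fun p hp i => fract_mem_Ioo_of_forall_abs_gt (hc i _ ?_)⟩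
  exact Finset.mem_image.2 ⟨p, hp, rfl⟩

omit [Fintype ι] in
/-- **Reduction to the core**: if all coordinates of `p` minus `c` have fractional part in
`(2δ, 1 - 2δ)`, then `p - Ψ ⌊y(p) - c⌋` lies in the core. [folklore] -/
theorem sub_latVec_floor_mem_core {c : ι → ℝ} {δ : ℝ} {p : E}
    (hp : ∀ i, Int.fract (coord Ψ p i - c i) ∈ Ioo (2 * δ) (1 - 2 * δ)) :
    p - latVec Ψ (fun i => ⌊coord Ψ p i - c i⌋) ∈ core Ψ c δ := by
  intro i
  rw [coord_sub_latVec]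
  have h := hp i
  rw [Int.fract] at h
  convert h using 1
  ring

end Generic

end LatticePU

end Literature.Analysis.FunctionSpaces
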